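import Summits.Ventures.LatticeQCDFlow.Scaling.UntouchedReplicas
import Literature.Probability.MarkovChains.HypercubeLowerBound

/-!
HONEST FRAMING: exact (Metropolis-corrected) sampling algorithms for lattice gauge theory; figures
of merit are autocorrelation/cost numbers at stated couplings and volumes; no continuum-physics
claim.

# TouchChainMoments — THE COUPON-COLLECTOR ESTIMATE FOR THE TOUCH CHAIN: THE INDICATORS `𝟙{k ∈ V}` ARE EIGENFUNCTIONS
# (EIGENVALUE `1 − θ_k`, `θ_k = Σ_{a ∋ k} c_a`), PAIRS ON AN INDEPENDENT SET ARE EIGENFUNCTIONS (`1 − θ_k − θ_l`), SO THE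
# UNTOUCHED COUNT HAS MEAN `s_n = Σ_{k∈T}(1−θ_k)ⁿ` AND SECOND MOMENT `≤ s_n + s_n²`, AND BY CHEBYSHEV
# `(δ_T Rⁿ)(∅) ≤ 1/s_n` (lean-2 GEN-24, ours)

Venture-side (OURS).  Cell `lqcd-flow` (pub-lqcd), unit `pub-lqcd-lean-2-g24`, 2026-08-27.  Chapter L (the coupon-collector
law from a cold start), file 2.  The TOUCH CHAIN of `Scaling/UntouchedReplicas` — `R(U,V) = Σ_a c_a·𝟙{V = U ∖ τ a}` on
`Finset L`, weights `c ≥ 0`, `Σ c = 1`, touched sets `τ a` (hypothesis-equation `hR`, no definitions) — started from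
`δ_T`.  `θ_k := Σ_{a : k ∈ τ a} c_a` is the probability that one step touches coordinate `k`; a set `T` is INDEPENDENT for
the schedule when no move touches two distinct coordinates of `T` (`∀ a, k ≠ l ∈ T ⇒ ¬(k ∈ τ a ∧ l ∈ τ a)`; for a swap
list: no entry joins two levels of `T`).

## What is proved

* §1 one step: **`touch_step_indicator`** (`Σ_V R(U,V)𝟙{k∈V} = (1 − θ_k)𝟙{k∈U}`), **`touch_step_pairIndicator`**
  (`Σ_V R(U,V)𝟙{k∈V}𝟙{l∈V} = (1 − θ_k − θ_l)𝟙{k∈U}𝟙{l∈U}` when no move touches both), `touchRate_nonneg`/`_le_one`,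
  `one_sub_touchRate_pair_nonneg`.
* §2 all times (Levin–Peres–Wilmer eq. (12.2) as typed in `Literature/…/HypercubeLowerBound`):
  **`touch_lawAt_indicator`** (`E_{δ_T Rⁿ}𝟙{k∈V} = (1−θ_k)ⁿ𝟙{k∈T}`), **`touch_lawAt_pairIndicator`**.
* §3 **`touch_lawAt_mean_count`** (`E N_T = s_n := Σ_{k∈T}(1−θ_k)ⁿ`), **`touch_lawAt_sq_count_le`**
  (`E N_T² ≤ s_n + s_n²` on an independent `T`).
* §4 **`touch_lawAt_empty_le` (THE COUPON-COLLECTOR ESTIMATE)** — on an independent `T` with `s_n > 0`: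
  **`(δ_T Rⁿ)(∅) ≤ 1/s_n`** (Chebyshev: `ρ(∅)·s_n² ≤ E(N_T − s_n)² = E N_T² − s_n² ≤ s_n`).

Reading (no numerics implied): the schedule has touched all of `T` by time `n` with probability at most `1/s_n`; with
`|T|` coordinates each touched with probability `≤ θ` per step, `s_n ≥ |T|(1−θ)ⁿ`, which exceeds `1/ε'` until
`n ≈ (1/θ)·log(|T|ε')` — the coupon-collector time.  NOT CLAIMED: the matching upper tail; dependent schedules.
Literature grade (cell rule): KNOWN MECHANISM (Levin–Peres–Wilmer Lemma 7.13 / Prop. 7.14, Chebyshev on the number of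
uncollected coupons), NEW TYPING for non-uniform, lazy, set-valued schedules; nothing cited as a fact; no new bib keys.
-/

noncomputable section

open Finset Function
open Literature.Probability.MarkovChains

namespace Summit.Ventures.LatticeQCDFlow.Scaling

variable {L ι : Type*} [Fintype L] [DecidableEq L] [Fintype ι] {c : ι → ℝ} {τ : ι → Finset L}
  {R : Finset L → Finset L → ℝ}

/-! ## §1 One step: indicators of untouched coordinates are eigenfunctions -/

omit [Fintype L] in
/-- The weights of the moves NOT touching `k` sum to `1 − θ_k`. [ours] -/
theorem sum_filter_not_mem_touch (hc1 : ∑ a, c a = 1) (k : L) :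
    ∑ a ∈ univ.filter (fun a => k ∉ τ a), c a = 1 - ∑ a ∈ univ.filter (fun a => k ∈ τ a), c a := by
  have h := Finset.sum_filter_add_sum_filter_not univ (fun a => k ∈ τ a) c
  linarith

omit [Fintype L] in
/-- `0 ≤ θ_k`. [ours] -/
theorem touchRate_nonneg (hc : ∀ a, 0 ≤ c a) (k : L) : 0 ≤ ∑ a ∈ univ.filter (fun a => k ∈ τ a), c a :=
  sum_nonneg fun a _ => hc a

omit [Fintype L] in
/-- `θ_k ≤ 1`. [ours] -/
theorem touchRate_le_one (hc : ∀ a, 0 ≤ c a) (hc1 : ∑ a, c a = 1) (k : L) :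
    ∑ a ∈ univ.filter (fun a => k ∈ τ a), c a ≤ 1 := by
  rw [← hc1]; exact sum_le_univ_sum_of_nonneg hc

omit [Fintype L] in
/-- On a pair no move touches jointly, the weights of the moves touching NEITHER sum to `1 − θ_k − θ_l`. [ours] -/
theorem sum_filter_not_mem_touch_pair (hc1 : ∑ a, c a = 1) {k l : L} (hkl : ∀ a, ¬(k ∈ τ a ∧ l ∈ τ a)) :
    ∑ a ∈ univ.filter (fun a => k ∉ τ a ∧ l ∉ τ a), c a
      = 1 - ∑ a ∈ univ.filter (fun a => k ∈ τ a), c a - ∑ a ∈ univ.filter (fun a => l ∈ τ a), c a := by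
  -- the three filters partition `univ`
  have h1 := Finset.sum_filter_add_sum_filter_not univ (fun a => k ∈ τ a) c
  have h2 := Finset.sum_filter_add_sum_filter_not (univ.filter (fun a => k ∉ τ a)) (fun a => l ∈ τ a) c
  have h3 : (univ.filter (fun a => k ∉ τ a)).filter (fun a => l ∈ τ a) = univ.filter (fun a => l ∈ τ a) := by
    ext a
    simp only [Finset.mem_filter, Finset.mem_univ, true_and]
    exact ⟨fun h => h.2, fun h => ⟨fun hk => hkl a ⟨hk, h⟩, h⟩⟩
  have h4 : (univ.filter (fun a => k ∉ τ a)).filter (fun a => ¬(l ∈ τ a))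
      = univ.filter (fun a => k ∉ τ a ∧ l ∉ τ a) := by
    ext a
    simp only [Finset.mem_filter, Finset.mem_univ, true_and]
  rw [h3, h4] at h2
  linarith

omit [Fintype L] in
/-- `0 ≤ 1 − θ_k − θ_l` on a pair no move touches jointly. [ours] -/
theorem one_sub_touchRate_pair_nonneg (hc : ∀ a, 0 ≤ c a) (hc1 : ∑ a, c a = 1) {k l : L}
    (hkl : ∀ a, ¬(k ∈ τ a ∧ l ∈ τ a)) :
    0 ≤ 1 - ∑ a ∈ univ.filter (fun a => k ∈ τ a), c a - ∑ a ∈ univ.filter (fun a => l ∈ τ a), c a := by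
  rw [← sum_filter_not_mem_touch_pair hc1 hkl]; exact sum_nonneg fun a _ => hc a

/-- **ONE STEP, ONE COORDINATE:** `Σ_V R(U,V)·𝟙{k ∈ V} = (1 − θ_k)·𝟙{k ∈ U}`. [ours] -/
theorem touch_step_indicator (hc1 : ∑ a, c a = 1)
    (hR : ∀ U V, R U V = ∑ a, c a * (if V = U \ τ a then (1 : ℝ) else 0)) (k : L) (U : Finset L) :
    ∑ V, R U V * (if k ∈ V then (1 : ℝ) else 0)
      = (1 - ∑ a ∈ univ.filter (fun a => k ∈ τ a), c a) * (if k ∈ U then (1 : ℝ) else 0) := by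
  simp_rw [hR, sum_mul]
  rw [sum_comm]
  have h : ∀ a, ∑ V : Finset L, c a * (if V = U \ τ a then (1 : ℝ) else 0) * (if k ∈ V then (1 : ℝ) else 0)
      = c a * (if k ∈ U \ τ a then (1 : ℝ) else 0) := by
    intro a
    simp_rw [mul_assoc, ← mul_sum]
    congr 1
    rw [Finset.sum_eq_single (U \ τ a)]
    · rw [if_pos rfl, one_mul]
    · intro V _ hV; rw [if_neg hV, zero_mul]
    · intro h'; exact absurd (mem_univ _) h'
  simp_rw [h, Finset.mem_sdiff]
  rw [← sum_filter_not_mem_touch hc1 k, Finset.sum_filter, sum_mul]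
  refine sum_congr rfl fun a _ => ?_
  by_cases hk : k ∈ U <;> by_cases ha : k ∈ τ a <;> simp [hk, ha]

/-- **ONE STEP, A PAIR NO MOVE TOUCHES JOINTLY:** `Σ_V R(U,V)·𝟙{k ∈ V}𝟙{l ∈ V} = (1 − θ_k − θ_l)·𝟙{k ∈ U}𝟙{l ∈ U}`.
[ours] -/
theorem touch_step_pairIndicator (hc1 : ∑ a, c a = 1)
    (hR : ∀ U V, R U V = ∑ a, c a * (if V = U \ τ a then (1 : ℝ) else 0)) {k l : L}
    (hkl : ∀ a, ¬(k ∈ τ a ∧ l ∈ τ a)) (U : Finset L) :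
    ∑ V, R U V * ((if k ∈ V then (1 : ℝ) else 0) * (if l ∈ V then (1 : ℝ) else 0))
      = (1 - ∑ a ∈ univ.filter (fun a => k ∈ τ a), c a - ∑ a ∈ univ.filter (fun a => l ∈ τ a), c a)
          * ((if k ∈ U then (1 : ℝ) else 0) * (if l ∈ U then (1 : ℝ) else 0)) := by
  simp_rw [hR, sum_mul]
  rw [sum_comm]
  have h : ∀ a, ∑ V : Finset L, c a * (if V = U \ τ a then (1 : ℝ) else 0)
        * ((if k ∈ V then (1 : ℝ) else 0) * (if l ∈ V then (1 : ℝ) else 0))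
      = c a * ((if k ∈ U \ τ a then (1 : ℝ) else 0) * (if l ∈ U \ τ a then (1 : ℝ) else 0)) := by
    intro a
    simp_rw [mul_assoc, ← mul_sum]
    congr 1
    rw [Finset.sum_eq_single (U \ τ a)]
    · rw [if_pos rfl, one_mul]
    · intro V _ hV; rw [if_neg hV, zero_mul]
    · intro h'; exact absurd (mem_univ _) h'
  simp_rw [h, Finset.mem_sdiff]
  rw [← sum_filter_not_mem_touch_pair hc1 hkl, Finset.sum_filter, sum_mul]
  refine sum_congr rfl fun a _ => ?_
  by_cases hk : k ∈ U <;> by_cases hl : l ∈ U <;> by_cases ha : k ∈ τ a <;> by_cases hb : l ∈ τ a <;>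
    simp [hk, hl, ha, hb]

/-! ## §2 All times -/

/-- **`E_{δ_T Rⁿ} 𝟙{k ∈ V} = (1 − θ_k)ⁿ·𝟙{k ∈ T}`** — coordinate `k` is untouched at time `n` with probability exactly
`(1 − θ_k)ⁿ`. [ours] -/
theorem touch_lawAt_indicator (hc1 : ∑ a, c a = 1)
    (hR : ∀ U V, R U V = ∑ a, c a * (if V = U \ τ a then (1 : ℝ) else 0)) (T : Finset L) (k : L) (n : ℕ) :
    lawMean (lawAt R (Pi.single T 1) n) (fun V => if k ∈ V then (1 : ℝ) else 0)
      = (1 - ∑ a ∈ univ.filter (fun a => k ∈ τ a), c a) ^ n * (if k ∈ T then (1 : ℝ) else 0) := by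
  rw [lawMean_lawAt_of_eigen R (Pi.single T 1) (fun U => touch_step_indicator hc1 hR k U) n, lawMean_single]

/-- **`E_{δ_T Rⁿ} 𝟙{k ∈ V}𝟙{l ∈ V} = (1 − θ_k − θ_l)ⁿ·𝟙{k ∈ T}𝟙{l ∈ T}`** when no move touches `k` and `l` jointly.
[ours] -/
theorem touch_lawAt_pairIndicator (hc1 : ∑ a, c a = 1)
    (hR : ∀ U V, R U V = ∑ a, c a * (if V = U \ τ a then (1 : ℝ) else 0)) (T : Finset L) {k l : L}
    (hkl : ∀ a, ¬(k ∈ τ a ∧ l ∈ τ a)) (n : ℕ) :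
    lawMean (lawAt R (Pi.single T 1) n) (fun V => (if k ∈ V then (1 : ℝ) else 0) * (if l ∈ V then (1 : ℝ) else 0))
      = (1 - ∑ a ∈ univ.filter (fun a => k ∈ τ a), c a - ∑ a ∈ univ.filter (fun a => l ∈ τ a), c a) ^ n
          * ((if k ∈ T then (1 : ℝ) else 0) * (if l ∈ T then (1 : ℝ) else 0)) := by
  rw [lawMean_lawAt_of_eigen R (Pi.single T 1) (fun U => touch_step_pairIndicator hc1 hR hkl U) n, lawMean_single]

/-! ## §3 Mean and second moment of the untouched count `N_T(V) = Σ_{k∈T} 𝟙{k ∈ V}` -/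

/-- **`E_{δ_T Rⁿ} N_T = s_n := Σ_{k∈T} (1 − θ_k)ⁿ`.** [ours] -/
theorem touch_lawAt_mean_count (hc1 : ∑ a, c a = 1)
    (hR : ∀ U V, R U V = ∑ a, c a * (if V = U \ τ a then (1 : ℝ) else 0)) (T : Finset L) (n : ℕ) :
    lawMean (lawAt R (Pi.single T 1) n) (fun V => ∑ k ∈ T, if k ∈ V then (1 : ℝ) else 0)
      = ∑ k ∈ T, (1 - ∑ a ∈ univ.filter (fun a => k ∈ τ a), c a) ^ n := by
  unfold lawMean
  simp_rw [mul_sum]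
  rw [sum_comm]
  refine sum_congr rfl fun k hk => ?_
  have h := touch_lawAt_indicator hc1 hR T k n
  unfold lawMean at h
  rw [h, if_pos hk, mul_one]

/-- **`E_{δ_T Rⁿ} N_T² ≤ s_n + s_n²`** on an independent `T` (`c ≥ 0`): the diagonal gives `s_n`, each off-diagonal pair
`(1 − θ_k − θ_l)ⁿ ≤ (1 − θ_k)ⁿ(1 − θ_l)ⁿ`. [ours] -/
theorem touch_lawAt_sq_count_le (hc : ∀ a, 0 ≤ c a) (hc1 : ∑ a, c a = 1)
    (hR : ∀ U V, R U V = ∑ a, c a * (if V = U \ τ a then (1 : ℝ) else 0)) (T : Finset L)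
    (hT : ∀ a, ∀ k ∈ T, ∀ l ∈ T, k ≠ l → ¬(k ∈ τ a ∧ l ∈ τ a)) (n : ℕ) :
    lawMean (lawAt R (Pi.single T 1) n) (fun V => (∑ k ∈ T, if k ∈ V then (1 : ℝ) else 0) ^ 2)
      ≤ (∑ k ∈ T, (1 - ∑ a ∈ univ.filter (fun a => k ∈ τ a), c a) ^ n)
        + (∑ k ∈ T, (1 - ∑ a ∈ univ.filter (fun a => k ∈ τ a), c a) ^ n) ^ 2 := by
  set ρ := lawAt R (Pi.single T 1) n with hρ
  set q : L → ℝ := fun k => (1 - ∑ a ∈ univ.filter (fun a => k ∈ τ a), c a) ^ n with hq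
  -- expand the square: `N² = Σ_k Σ_l 𝟙{k}𝟙{l}`, split the diagonal
  have hsq : ∀ V : Finset L, (∑ k ∈ T, if k ∈ V then (1 : ℝ) else 0) ^ 2
      = ∑ k ∈ T, ∑ l ∈ T, (if k ∈ V then (1 : ℝ) else 0) * (if l ∈ V then (1 : ℝ) else 0) := by
    intro V; rw [sq, Finset.sum_mul_sum]
  have hmean : lawMean ρ (fun V => (∑ k ∈ T, if k ∈ V then (1 : ℝ) else 0) ^ 2)
      = ∑ k ∈ T, ∑ l ∈ T, lawMean ρ (fun V => (if k ∈ V then (1 : ℝ) else 0) * (if l ∈ V then (1 : ℝ) else 0)) := by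
    unfold lawMean
    simp_rw [hsq, mul_sum]
    rw [sum_comm]
    refine sum_congr rfl fun k _ => ?_
    rw [sum_comm]
  rw [hmean]
  -- each term: diagonal `= q k`, off-diagonal `= (1 − θ_k − θ_l)ⁿ ≤ q k * q l`
  have hterm : ∀ k ∈ T, ∀ l ∈ T,
      lawMean ρ (fun V => (if k ∈ V then (1 : ℝ) else 0) * (if l ∈ V then (1 : ℝ) else 0))
        ≤ (if k = l then q k else 0) + q k * q l := by
    intro k hk l hl
    by_cases hkl : k = l
    · subst hkl
      have hid : (fun V : Finset L => (if k ∈ V then (1 : ℝ) else 0) * (if k ∈ V then (1 : ℝ) else 0))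
          = fun V => if k ∈ V then (1 : ℝ) else 0 := by
        funext V; split_ifs <;> norm_num
      rw [hid, hρ, touch_lawAt_indicator hc1 hR T k n, if_pos hk, mul_one, if_pos rfl]
      have : 0 ≤ q k * q k := mul_self_nonneg _
      rw [hq] at this ⊢; linarith
    · have hkl' : ∀ a, ¬(k ∈ τ a ∧ l ∈ τ a) := fun a => hT a k hk l hl hkl
      rw [hρ, touch_lawAt_pairIndicator hc1 hR T hkl' n, if_pos hk, if_pos hl, mul_one, mul_one, if_neg hkl, zero_add,
        hq]
      dsimp only
      rw [← mul_pow]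
      apply pow_le_pow_left₀ (one_sub_touchRate_pair_nonneg hc hc1 hkl')
      nlinarith [touchRate_nonneg (τ := τ) hc k, touchRate_nonneg (τ := τ) hc l]
  calc ∑ k ∈ T, ∑ l ∈ T, lawMean ρ (fun V => (if k ∈ V then (1 : ℝ) else 0) * (if l ∈ V then (1 : ℝ) else 0))
      ≤ ∑ k ∈ T, ∑ l ∈ T, ((if k = l then q k else 0) + q k * q l) :=
        sum_le_sum fun k hk => sum_le_sum fun l hl => hterm k hk l hl
    _ = ∑ k ∈ T, q k + (∑ k ∈ T, q k) ^ 2 := by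
        simp_rw [sum_add_distrib]
        rw [sq, Finset.sum_mul_sum]
        congr 1
        exact sum_congr rfl fun k hk => by rw [Finset.sum_ite_eq T k, if_pos hk]

/-! ## §4 Chebyshev: the schedule has touched everything with probability at most `1/s_n` -/

/-- **THE COUPON-COLLECTOR ESTIMATE:** on an independent `T`, with `s_n = Σ_{k∈T}(1−θ_k)ⁿ > 0`,
**`(δ_T Rⁿ)(∅) ≤ 1/s_n`**. [ours] -/
theorem touch_lawAt_empty_le (hc : ∀ a, 0 ≤ c a) (hc1 : ∑ a, c a = 1)
    (hR : ∀ U V, R U V = ∑ a, c a * (if V = U \ τ a then (1 : ℝ) else 0)) (T : Finset L)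
    (hT : ∀ a, ∀ k ∈ T, ∀ l ∈ T, k ≠ l → ¬(k ∈ τ a ∧ l ∈ τ a)) (n : ℕ)
    (hs : 0 < ∑ k ∈ T, (1 - ∑ a ∈ univ.filter (fun a => k ∈ τ a), c a) ^ n) :
    lawAt R (Pi.single T 1) n ∅ ≤ 1 / ∑ k ∈ T, (1 - ∑ a ∈ univ.filter (fun a => k ∈ τ a), c a) ^ n := by
  set ρ := lawAt R (Pi.single T 1) n with hρ
  set s := ∑ k ∈ T, (1 - ∑ a ∈ univ.filter (fun a => k ∈ τ a), c a) ^ n with hs_def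
  set N : Finset L → ℝ := fun V => ∑ k ∈ T, if k ∈ V then (1 : ℝ) else 0 with hN
  have hRst := touch_isRowStochastic hc hc1 hR
  have hρ0 : ∀ V, 0 ≤ ρ V := fun V => lawAt_nonneg hRst (fun U => by
    by_cases h : U = T
    · subst h; rw [Pi.single_eq_same]; norm_num
    · rw [Pi.single_eq_of_ne h]) n V
  have hρ1 : ∑ V, ρ V = 1 := by
    rw [hρ, sum_lawAt hRst, Finset.sum_pi_single', if_pos (mem_univ _)]
  have hEN : ∑ V, ρ V * N V = s := touch_lawAt_mean_count hc1 hR T n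
  have hEN2 : ∑ V, ρ V * N V ^ 2 ≤ s + s ^ 2 := touch_lawAt_sq_count_le hc hc1 hR T hT n
  -- Chebyshev at the atom `∅`, where `N = 0`
  have hN0 : N ∅ = 0 := sum_eq_zero fun k _ => if_neg (Finset.notMem_empty k)
  have hcheb : ρ ∅ * s ^ 2 ≤ ∑ V, ρ V * (N V - s) ^ 2 := by
    have : ρ ∅ * s ^ 2 = ρ ∅ * (N ∅ - s) ^ 2 := by rw [hN0]; ring
    rw [this]
    exact Finset.single_le_sum (f := fun V => ρ V * (N V - s) ^ 2) (fun V _ => mul_nonneg (hρ0 V) (sq_nonneg _))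
      (mem_univ ∅)
  have hexp : ∑ V, ρ V * (N V - s) ^ 2 = ∑ V, ρ V * N V ^ 2 - 2 * s * ∑ V, ρ V * N V + s ^ 2 * ∑ V, ρ V := by
    rw [Finset.mul_sum univ (fun V => ρ V * N V) (2 * s), Finset.mul_sum univ (fun V => ρ V) (s ^ 2),
      ← Finset.sum_sub_distrib, ← Finset.sum_add_distrib]
    exact sum_congr rfl fun V _ => by ring
  rw [hexp, hEN, hρ1] at hcheb
  -- `ρ(∅)·s² ≤ E N² − s² ≤ s`
  have h1 : ρ ∅ * s ^ 2 ≤ s := by nlinarith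
  rw [le_div_iff₀ hs]
  nlinarith [hρ0 ∅]

end Summit.Ventures.LatticeQCDFlow.Scaling

end
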